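import Summits.HubbardSuperconductivity.HubbardSuperconductivity.Theses.DeformationLadder
import Literature.MathematicalPhysics.QuantumLattice.HubbardWave0

/-!
# Ideator 6 (round 2) — typed hand-offs for crux `LowEnergyRigidity` (stmt-HubbardSuperconductivity-1892)

No idea card is filed this round (see `NegativeNotesIdeator6.md`).  This file only TYPES the one
new kinematic lemma handed to the disprover (lever L2, "total-spin squeeze"), so that the statement
is unambiguous.  It is deliberately left `sorry`: proving it is cdisprove / prover business.

Informal statement.  The singlet pair field `Δ_d = Σ_x P_x` removes one `↑` and one `↓` electron and
commutes with total spin; grouping `Δ_d = Σ_y A_y c_{y↓}` with `A_y = √2 Σ_e g_d(e) c_{y+e,↑}`,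
`‖A_y‖ ≤ 2√2`, gives for the highest-weight member of a spin-`S` multiplet in the `N`-particle space
`‖Δ_d φ‖² ≤ 8 L² ⟨N_↓⟩ = 8 L² (N/2 − S) ‖φ‖²`, and `Δ_dᴴΔ_d` is `SU(2)`-invariant, so the same bound
holds for the `S^z = 0` member.  Contrapositive for the crux: LRO density `≥ a` forces
`S ≤ N/2 − a L²/8` — every witness `(U,δ,κ,a,L₀)` of `LowEnergyRigidity` certifies that NO state of
total spin `S > N_L/2 − aL²/8` (partial, not only saturated, ferromagnetism) lies within `κ` of the
sector ground energy at any even `L ≥ L₀` (generalises `Disproof.rigidAt_false_of_ferromagnet_in_window`,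
which is the case `S = N_L/2`).
-/

set_option linter.dupNamespace false

namespace Summit.HubbardSuperconductivity.HubbardSuperconductivity.Cruxes.LowEnergyRigidity.Ideator6

open Literature.MathematicalPhysics.QuantumLattice Matrix
open scoped ComplexOrder

noncomputable section

/-- **L2 (total-spin squeeze), typed hand-off; NOT proved here.**  For a vector of the joint
sector `(N, S^z = 0)` on the fermionic torus of side `L` that is a total-spin eigenvector,
`S² φ = S(S+1) φ` with `S ≥ 0`, the `d`-wave pair-field intensity obeys
`Re⟨φ, Δ_dᴴ Δ_d φ⟩ ≤ 8 L² (N/2 − S) ‖φ‖²`. -/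
theorem re_expect_pairField_le_of_spinSq (L : ℕ) [NeZero L] (N : ℕ) (S : ℝ) (hS : 0 ≤ S)
    (φ : Fock (Orb (FermionTorus 2 L)))
    (hφ : φ ∈ szSector (Λ := FermionTorus 2 L) N 0)
    (hspin : spinSq *ᵥ φ = ((S * (S + 1) : ℝ) : ℂ) • φ) :
    (expect ((pairField dWaveFormFactor L)ᴴ * pairField dWaveFormFactor L) φ).re ≤
      8 * (L : ℝ) ^ 2 * ((N : ℝ) / 2 - S) * (star φ ⬝ᵥ φ).re := by
  sorry

/-- Corollary shape for the disprover (also left open): a total-spin-`S` eigenvector of the crux's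
sector with `S > N_L/2 − a L²/8` inside the `κ`-window refutes `RigidAt U δ κ a L` — the partial-
polarisation extension of `rigidAt_false_of_ferromagnet_in_window`.  Stated over the crux's own
objects; `RigidAt` is inlined to keep this file independent of `Disproof.lean`. -/
theorem not_rigid_of_polarised_window_state (L : ℕ) [NeZero L] {U δ κ a S : ℝ}
    (φ : Fock (Orb (FermionTorus 2 L)))
    (hφ : φ ∈ szSector (Λ := FermionTorus 2 L) (2 * ⌊(1 - δ) * (L : ℝ) ^ 2 / 2⌋₊) 0)
    (hφ1 : star φ ⬝ᵥ φ = 1)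
    (hspin : spinSq *ᵥ φ = ((S * (S + 1) : ℝ) : ℂ) • φ) (hS : 0 ≤ S)
    (hpol : ((2 * ⌊(1 - δ) * (L : ℝ) ^ 2 / 2⌋₊ : ℕ) : ℝ) / 2 - a * (L : ℝ) ^ 2 / 8 < S)
    (hwin : (star φ ⬝ᵥ Matrix.mulVec (hubbardTorus 2 L 1 U) φ).re ≤
      (hubbardTorus 2 L 1 U).minEnergyOn
        (szSector (Λ := FermionTorus 2 L) (2 * ⌊(1 - δ) * (L : ℝ) ^ 2 / 2⌋₊) 0) + κ) :
    ¬ (∀ ψ : Fock (Orb (FermionTorus 2 L)),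
        ψ ∈ szSector (Λ := FermionTorus 2 L) (2 * ⌊(1 - δ) * (L : ℝ) ^ 2 / 2⌋₊) 0 →
        star ψ ⬝ᵥ ψ = 1 →
        (star ψ ⬝ᵥ Matrix.mulVec (hubbardTorus 2 L 1 U) ψ).re ≤
          (hubbardTorus 2 L 1 U).minEnergyOn
            (szSector (Λ := FermionTorus 2 L) (2 * ⌊(1 - δ) * (L : ℝ) ^ 2 / 2⌋₊) 0) + κ →
        a ≤ (expect ((pairField dWaveFormFactor L)ᴴ * pairField dWaveFormFactor L) ψ).re /
          (L : ℝ) ^ 4) := by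
  intro h
  have hLRO := h φ hφ hφ1 hwin
  have hsq := re_expect_pairField_le_of_spinSq L _ S hS φ hφ hspin
  rw [hφ1] at hsq
  simp only [Complex.one_re, mul_one] at hsq
  have hL : (0 : ℝ) < (L : ℝ) ^ 4 := by
    have : (0 : ℝ) < (L : ℝ) := by exact_mod_cast Nat.pos_of_ne_zero (NeZero.ne L)
    positivity
  rw [le_div_iff₀ hL] at hLRO
  -- a L⁴ ≤ Re⟨Δ†Δ⟩ ≤ 8 L² (N/2 − S) < 8 L² · a L²/8 = a L⁴ : contradiction
  have hLpos : (0 : ℝ) < (L : ℝ) := by exact_mod_cast Nat.pos_of_ne_zero (NeZero.ne L)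
  have hL2 : (0 : ℝ) < (L : ℝ) ^ 2 := by positivity
  have hlt : 8 * (L : ℝ) ^ 2 * (((2 * ⌊(1 - δ) * (L : ℝ) ^ 2 / 2⌋₊ : ℕ) : ℝ) / 2 - S) <
      a * (L : ℝ) ^ 4 := by
    have h1 : (((2 * ⌊(1 - δ) * (L : ℝ) ^ 2 / 2⌋₊ : ℕ) : ℝ) / 2 - S) < a * (L : ℝ) ^ 2 / 8 := by
      linarith
    have h2 := mul_lt_mul_of_pos_left h1 (mul_pos (by norm_num : (0:ℝ) < 8) hL2)
    calc 8 * (L : ℝ) ^ 2 * (((2 * ⌊(1 - δ) * (L : ℝ) ^ 2 / 2⌋₊ : ℕ) : ℝ) / 2 - S)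
        < 8 * (L : ℝ) ^ 2 * (a * (L : ℝ) ^ 2 / 8) := h2
      _ = a * (L : ℝ) ^ 4 := by ring
  linarith
  
end

end Summit.HubbardSuperconductivity.HubbardSuperconductivity.Cruxes.LowEnergyRigidity.Ideator6
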